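import Summits.BirchSwinnertonDyer.Rank1Residual.Additive.CensusX42HeightPinning
import HarnessLib

/-!
# ERRATUM (census-ctyper1 GEN 8): the EXACT-grade `∀ Dh` packaging
# `∀ Dh, LeadingTermClauses W p Dh → CensusX42.RelationAt W p Dh` is jointly unsatisfiable with a
# (B)-datum — kernel witnesses, and the list of this seat's theorems that are therefore VACUOUS
# (cell `b2b-bsdres`, census cell `bsd-formula-census`, seat `b2b-bsdres-census-ctyper1` =
# conjecture-typer 1, gen 8; prequels `CensusX42HeightRescaling.lean`, `CensusX42HeightPinning.lean`)

HONEST FRAMING (cell `b2b-bsdres`, run/shared/lean/b2b/bsd-rank1-residual/, verbatim in every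
file): the goal of the cell is to DELETE the COMBINATION-SHAPED residual classes of the
Birch–Swinnerton-Dyer formula for ALL analytic-rank `≤ 1` elliptic curves over `ℚ` — "full BSD
formula for every rank `≤ 1` curve in class `C`" assembled STRICTLY from published theorems — so
that the rank-`≤ 1` remainder becomes exactly the CONSTRUCTION-SHAPED classes, which are TYPED
(missing-input `Prop`s), NOT attempted. This is not "finishing BSD". Census cell
(bsd-formula-census): research instrumentation; census output = EVIDENCE / conjecture items, never a
Literature fact; labels / RESIDUAL-MAP marks UNCHANGED (O7-ord OPEN; X3♯ / X4♯ CONSTRUCTION-SHAPED);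
nothing booked. Theorems only (no definition, no named fact); named facts enter as HYPOTHESES
(`hDel` / `hDel3` / `hDelM`, `hGZ`, `hGZK`, `hmodD`). This file REFUTES a hypothesis SHAPE of this
seat's own earlier theorems; it refutes nothing about any curve, conjecture or published result.

## The finding (cell precedent: lead R5-42 / r2 II.16.1 on p260688 — vacuous theorems stay in the tree,
## are recorded as such in the kernel, and are never cited as coverage)

Delbourgo 2002 Thm. (B)'s clauses `LeadingTermClauses W p Dh` are an "up to a `p`-adic unit" statement,
hence invariant under `Dh ↦ u·Dh`, `u ∈ ℤ_p^×` (prequel I), whereas the EXACT census relation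
`CensusX42.RelationAt W p Dh` (gen 2, p252477; unit `α♭⁻¹(·c_∞(E))` PINNED) pins `Reg_p(E,Dh)` on the
nose (prequel II). So on every row where the relation is instantiable — (G-ord, `e = 2`) or (M),
`r_an = 1`, odd `p`; GZ, GZK and modularity data as the usual fact-hypotheses — the packaging
`∀ Dh, LeadingTermClauses W p Dh → RelationAt W p Dh` together with `∃ Dh, LeadingTermClauses W p Dh`
proves `False`: `Dh` and `−Dh` both satisfy the clauses (`leadingTermClauses_iff_of_pairing_eq_units_mul`), hence both
satisfy the exact relation, hence `Reg_p(E,Dh) = Reg_p(E,−Dh) = −Reg_p(E,Dh)` (`padicRegulator_eq_of_relationAt_of_relationAt`,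
rank one), so `Reg_p = 0`, against the clause `[T¹]L ≠ 0` (`schneider_of_relationAt`). Kernel witnesses:
`not_forall_leadingTermClauses_imp_relationAt` ((G-ord, `e = 2`), from `∃ Dh`), `…_mult` ((M)),
`…_mult_of_delbourgo` ((M), Delbourgo's (M) fact supplies the datum), and the class-level forms
`ClassX4Gord.not_forall_leadingTermClauses_imp_censusX42[_three]_of_delbourgo`, `ClassX3Gord.…`,
`ClassX4M.…`, `ClassX3M.…` whose binder lists are EXACTLY those of the affected theorems.

## ERRATUM — the affected theorems (census-ctyper1 gens 3/4/6; all TRUE VACUOUSLY; NOT coverage)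

ALL 24 theorems of this seat whose binder list carries
`hrel : ∀ Dh : PAdicHeightData W p, LeadingTermClauses W p Dh → CensusX42.RelationAt W p Dh`
ALSO carry a source of `∃ Dh, LeadingTermClauses W p Dh` — Delbourgo 2002 as `hDel : mainTheorem`
(A175) / `hDel3 : mainTheorem_three` / `hDelM : mainTheorem_potMult` (A190) — and the row data that
instantiate the relation; their hypotheses are jointly unsatisfiable (modulo the published facts
`hGZ`, `hGZK`, `hmodD` they carry as well). They stay in the tree and must NOT be cited as per-pair or
class coverage (every `…forall_censusX42…` name WITHOUT `Val`):
`CensusX42BSDCorollaries.lean` (p255529) `ClassX4Gord.bsdp_of_forall_censusX42_of_katoHalf_of_cert`;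
`CensusX42BSDMult.lean` (p255541) `ClassX4M.bsdp_of_forall_censusX42_of_katoHalf_of_multCert`;
`CensusX42BSDIMC.lean` (p259429, 13) `ClassX4Gord.bsdp_rankOne_of_chiBranchLower[Odd]_of_katoHalf_of_forall_censusX42`,
`ClassX4Gord.bsdp_three_rankOne_of_chiBranchLowerOdd_of_katoHalf_of_forall_censusX42`,
`ClassX3Gord.bsdp_rankOne_of_chiBranchLower[Odd]_of_wuthrichHalf_of_forall_censusX42`,
`ClassX3Gord.bsdp_three_rankOne_of_chiBranchLowerOdd_of_wuthrichHalf_of_forall_censusX42`,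
`ClassX4Gord.bsdp_rankOne_of_katoHalf_of_coeffCert_of_budget_of_forall_censusX42[_odd]`,
`ClassX4Gord.bsdp_three_rankOne_of_katoHalf_of_coeffCert_of_budget_of_forall_censusX42`,
`ClassX4M.bsdp_rankOne_of_quadraticBranchLower_of_katoHalf_of_forall_censusX42`,
`ClassX3M.bsdp_rankOne_of_quadraticBranchLower_of_wuthrichHalf_of_forall_censusX42`,
`ClassX4M.bsdp_rankOne_of_katoHalf_of_multFirstUnitIndexAt_of_budget_of_forall_censusX42`,
`ClassX3M.bsdp_rankOne_of_wuthrichHalf_of_multFirstUnitIndexAt_of_budget_of_forall_censusX42`;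
`CensusX42CoeffValuation.lean` (p260391, 3) `ClassX4Gord.bsdp_rankOne_of_katoHalf_of_gord[Odd]FirstUnitIndexAt_of_budget_of_forall_censusX42`,
`ClassX4Gord.bsdp_three_rankOne_of_katoHalf_of_gordOddFirstUnitIndexAt_of_budget_of_forall_censusX42`;
`CensusX42UnitRows.lean` (p267238 §2, 6) `ClassX4Gord.bsdp[_three]_rankOne_of_katoHalf_of_delbourgo_of_forall_censusX42_of_shaAn_unit`,
`ClassX3Gord.bsdp[_three]_rankOne_of_wuthrichHalf_of_delbourgo_of_forall_censusX42_of_shaAn_unit`,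
`ClassX4M.bsdp_rankOne_of_katoHalf_of_delbourgo_of_forall_censusX42_of_shaAn_unit`,
`ClassX3M.bsdp_rankOne_of_wuthrichHalf_of_delbourgo_of_forall_censusX42_of_shaAn_unit`.
STATEMENTS OF RECORD replacing them: (i) the POINTWISE forms — one `Dh` carrying both
`hB : LeadingTermClauses W p Dh` and `hrel : RelationAt W p Dh` (every `…_of_censusX42_…` theorem
without `forall`; consistent — prequel II only says the relation pins WHICH `Dh`); (ii) the WINDOW-grade
`∀ Dh` forms over `CensusX42.ValRelationAt` (`CensusX42ValBridges` / `ValUnitRows` / `ValConverse` /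
`ValLoops` / `ValCoeffValuation`, p270586 / p271513 / p271550 / p272824 / p270612), unit-invariant
(prequel I; their one rider is prequel II §3); (iii) gen 2's `RelationAtCensusHeight W p`
(`CensusX42Height.lean`, p252895), whose `∀ Dh` ranges over data PINNED by `IsTwistSigmaHeight W p V Dh`.
No label, mark, count or reading of the cell changes: the exact relation was only ever EVIDENCE for
the census datum, and every kernel consumer of record reads it through its valuation shadow (gen 6).

References: D. Delbourgo, J. Number Theory 95 (2002) Thm. (A)/(B) (p. 40), p. 39 [Delbourgo2002];
B. Mazur, J. Tate, J. Teitelbaum, Invent. Math. 84 (1986) §I.13, Ch. II §4 [MazurTateTeitelbaum1986Invent];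
P. Schneider, Invent. Math. 69 (1982) §1 [Schneider1982PadicHeightI]; B. Gross, D. Zagier, Invent. Math.
84 (1986) Thm. I.(7.3) [GrossZagier1986]; cell files `cells/n1011/PLAN.md` R5-42 (precedent),
HOME/b2b-bsdres-census-ctyper1/README.md GEN 8.
-/

set_option autoImplicit false

noncomputable section

open scoped Classical MatrixGroups ModularForm NumberField

open CongruenceSubgroup WeierstrassCurve NumberField Literature.NumberTheory.EllipticCurves
  Literature.NumberTheory.EllipticCurves.ModularForms
  Literature.NumberTheory.EllipticCurves.Rank1Residual
  Literature.NumberTheory.EllipticCurves.Rank1Residual.Typed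
  Literature.NumberTheory.EllipticCurves.Delbourgo2002
  Literature.NumberTheory.GaloisRepresentations
  Literature.Barriers.BirchSwinnertonDyer
  IsDedekindDomain

namespace Summit.BirchSwinnertonDyer.Rank1Residual.Additive

namespace CensusX42

variable {W : WeierstrassCurve ℚ} {p : ℕ} [hp : Fact p.Prime]


/-! ### §1 Kernel witnesses: the `∀ Dh` packaging at EXACT grade is jointly unsatisfiable with a (B)-datum -/

/-- The unit `−1 ∈ ℤ_p^×`, coerced to `ℚ_p`, is `−1`. [folklore] -/
private theorem coe_neg_one_units : (((-1 : ℤ_[p]ˣ) : ℤ_[p]) : ℚ_[p]) = -1 := by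
  rw [Units.val_neg, Units.val_one, PadicInt.coe_neg, PadicInt.coe_one]

omit hp in
/-- Bookkeeping: a datum with pairing `−⟨,⟩_{Dh}` is the rescaling of `Dh` by the UNIT `−1 ∈ ℤ_p^×`. [folklore] -/
private theorem pairing_eq_neg_one_units_mul [Fact p.Prime] {Dh Dh' : PAdicHeightData W p}
    (hc : ∀ P Q, Dh'.pairing P Q = (-1 : ℚ_[p]) * Dh.pairing P Q) :
    ∀ P Q, Dh'.pairing P Q = (((-1 : ℤ_[p]ˣ) : ℤ_[p]) : ℚ_[p]) * Dh.pairing P Q := fun P Q ↦ by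
  rw [coe_neg_one_units]; exact hc P Q

/-- **VACUITY WITNESS, (G-ord, `e = 2`) rows, every odd `p`.** On a row where the exact relation is
instantiable (`TypeGOrd`, `Addv`, `e = 2`, `r_an = 1`; GZ, GZK, modularity data as facts), the
hypothesis `∀ Dh, LeadingTermClauses W p Dh → RelationAt W p Dh` is INCONSISTENT with
`∃ Dh, LeadingTermClauses W p Dh`: `Dh` and `−Dh` both satisfy the clauses (`leadingTermClauses_iff_of_pairing_eq_units_mul`), hence both
satisfy the exact relation, hence `Reg_p(E,Dh) = Reg_p(E,−Dh) = −Reg_p(E,Dh)` (`padicRegulator_eq_of_relationAt_of_relationAt`,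
rank one), so `Reg_p = 0`,
against `[T¹]L ≠ 0` (`schneider_of_relationAt`). [cite: Delbourgo2002, Theorem (B) (p. 40)]
[cite: MazurTateTeitelbaum1986Invent, §I.13, §II.4] -/
theorem not_forall_leadingTermClauses_imp_relationAt (hGZ : GrossZagier1986_thm_I_7_3)
    (hGZK : rank_eq_analyticRank_of_analyticRank_le_one)
    (hmodD : nonempty_modularParametrizationData) {W : WeierstrassCurve ℚ} [W.IsElliptic]
    [W.IsGloballyMinimal] (hp2 : p ≠ 2) (hG : TypeGOrd W p) (hadd : Addv W p)
    (he : semistabilityIndex W p = 2) (hr : W.analyticRank = 1)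
    (hex : ∃ Dh : PAdicHeightData W p, LeadingTermClauses W p Dh) :
    ¬ ∀ Dh : PAdicHeightData W p, LeadingTermClauses W p Dh → RelationAt W p Dh := by
  intro hrel
  obtain ⟨Dh, hB⟩ := hex
  obtain ⟨Dh', hc⟩ := exists_pairing_eq_mul (-1 : ℚ_[p]) Dh
  have hB' : LeadingTermClauses W p Dh' :=
    (leadingTermClauses_iff_of_pairing_eq_units_mul (-1) (pairing_eq_neg_one_units_mul hc)).mpr hB
  have hReg := padicRegulator_eq_of_relationAt_of_relationAt hGZ hGZK hmodD hp2 hG hadd he hr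
    (hrel Dh hB) (hrel Dh' hB')
  have hrk : W.mordellWeilRank = 1 := by rw [(hGZK W hr.le).1, hr]
  rw [padicRegulator_eq_of_pairing_eq_mul hc, hrk, pow_one, neg_one_mul, eq_neg_iff_add_eq_zero,
    add_self_eq_zero] at hReg
  exact schneider_of_relationAt hGZ hGZK hmodD hp2 hG hadd he hr (hrel Dh hB) hReg

/-- **VACUITY WITNESS, (M) rows (`PotMult`), every odd `p`.** [cite: Delbourgo2002, Theorem (B) (p. 40)]
[cite: MazurTateTeitelbaum1986Invent, §I.13, §II.4] -/
theorem not_forall_leadingTermClauses_imp_relationAt_mult (hGZ : GrossZagier1986_thm_I_7_3)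
    (hGZK : rank_eq_analyticRank_of_analyticRank_le_one)
    (hmodD : nonempty_modularParametrizationData) {W : WeierstrassCurve ℚ} [W.IsElliptic]
    [W.IsGloballyMinimal] (hp2 : p ≠ 2) (hpm : AdditivePotMult.PotMult W p) (hr : W.analyticRank = 1)
    (hex : ∃ Dh : PAdicHeightData W p, LeadingTermClauses W p Dh) :
    ¬ ∀ Dh : PAdicHeightData W p, LeadingTermClauses W p Dh → RelationAt W p Dh := by
  intro hrel
  obtain ⟨Dh, hB⟩ := hex
  obtain ⟨Dh', hc⟩ := exists_pairing_eq_mul (-1 : ℚ_[p]) Dh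
  have hB' : LeadingTermClauses W p Dh' :=
    (leadingTermClauses_iff_of_pairing_eq_units_mul (-1) (pairing_eq_neg_one_units_mul hc)).mpr hB
  have hReg := padicRegulator_eq_of_relationAt_of_relationAt_mult hGZ hGZK hmodD hp2 hpm hr
    (hrel Dh hB) (hrel Dh' hB')
  have hrk : W.mordellWeilRank = 1 := by rw [(hGZK W hr.le).1, hr]
  rw [padicRegulator_eq_of_pairing_eq_mul hc, hrk, pow_one, neg_one_mul, eq_neg_iff_add_eq_zero,
    add_self_eq_zero] at hReg
  exact schneider_of_relationAt_mult hGZ hGZK hmodD hp2 hpm hr (hrel Dh hB) hReg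

/-- The (M) witness with Delbourgo 2002 (potentially multiplicative case, `hDelM`) SUPPLYING the
(B)-datum: on EVERY `PotMult` row at every odd `p` with `r_an = 1`, the exact-grade `∀ Dh` packaging is
refuted outright (modulo the named facts). [cite: Delbourgo2002, Theorem (A), (B), Example (p. 40)] -/
theorem not_forall_leadingTermClauses_imp_relationAt_mult_of_delbourgo
    (hDelM : Delbourgo2002.mainTheorem_potMult) (hGZ : GrossZagier1986_thm_I_7_3)
    (hGZK : rank_eq_analyticRank_of_analyticRank_le_one)
    (hmodD : nonempty_modularParametrizationData) {W : WeierstrassCurve ℚ} [W.IsElliptic]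
    [W.IsGloballyMinimal] (hp2 : p ≠ 2) (hpm : AdditivePotMult.PotMult W p) (hr : W.analyticRank = 1) :
    ¬ ∀ Dh : PAdicHeightData W p, LeadingTermClauses W p Dh → RelationAt W p Dh :=
  not_forall_leadingTermClauses_imp_relationAt_mult hGZ hGZK hmodD hp2 hpm hr
    (hpm.delbourgo2002 hDelM hp2).2

end CensusX42

open CensusX42

variable {W : WeierstrassCurve ℚ} [W.IsElliptic] [W.IsGloballyMinimal] {p : ℕ} [hp : Fact p.Prime]

/-- **ERRATUM witness for `ClassX4Gord.…_of_delbourgo_of_forall_censusX42…` (p267238 §2) and the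
`hDel`-carrying `…_of_forall_censusX42` nodes of p259429 / p260391**: on X4♯(G-ord, `e = 2`) ∩ {`ρ̄`
onto}, `p ≥ 5`, `r_an = 1`, Delbourgo 2002 (A)+(B) (`hDel`, non-CM automatic) REFUTES the exact-grade
packaging `∀ Dh, LeadingTermClauses W p Dh → CensusX42.RelationAt W p Dh` — those theorems' hypotheses
are jointly unsatisfiable; they are true VACUOUSLY and are not coverage. Statements of record: the
pointwise forms and the window-grade (`ValRelationAt`) forms. [cite: Delbourgo2002, Theorem (A), (B) (p. 40)] -/
theorem ClassX4Gord.not_forall_leadingTermClauses_imp_censusX42_of_delbourgo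
    (hDel : Delbourgo2002.mainTheorem) (hGZ : GrossZagier1986_thm_I_7_3)
    (hGZK : rank_eq_analyticRank_of_analyticRank_le_one)
    (hmodD : nonempty_modularParametrizationData) (hX : ClassX4Gord W p)
    (he : semistabilityIndex W p = 2) (hp5 : 5 ≤ p) (hsurj : Surj W p) (hr : W.analyticRank = 1) :
    ¬ ∀ Dh : PAdicHeightData W p, LeadingTermClauses W p Dh → RelationAt W p Dh :=
  not_forall_leadingTermClauses_imp_relationAt hGZ hGZK hmodD hX.addv.1 hX.typeGOrd hX.addv.2 he hr
    (hDel.exists_leadingTermClauses hp5 (hX.not_hasCM_of_surj_of_five_le he hp5 hsurj) hX.1.2.1 hX.2)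

/-- **ERRATUM witness at `p = 3`** (`ClassX4Gord.bsdp_three_rankOne_of_katoHalf_of_delbourgo_of_forall_censusX42_of_shaAn_unit`
and the `hDel3`-carrying `_three_` nodes): on X4♯(G-ord)@3, non-CM, `r_an = 1`, Delbourgo 2002 at `3`
(`hDel3`) refutes the exact-grade `∀ Dh` packaging. [cite: Delbourgo2002, Theorem (A), (B), Example (p. 40)] -/
theorem ClassX4Gord.not_forall_leadingTermClauses_imp_censusX42_three_of_delbourgo
    [Fact (Nat.Prime 3)] {W : WeierstrassCurve ℚ} [W.IsElliptic] [W.IsGloballyMinimal]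
    (hDel3 : Delbourgo2002.mainTheorem_three) (hGZ : GrossZagier1986_thm_I_7_3)
    (hGZK : rank_eq_analyticRank_of_analyticRank_le_one)
    (hmodD : nonempty_modularParametrizationData) (hX : ClassX4Gord W 3) (hcm : ¬ W.HasCM)
    (hr : W.analyticRank = 1) :
    ¬ ∀ Dh : PAdicHeightData W 3, LeadingTermClauses W 3 Dh → RelationAt W 3 Dh :=
  not_forall_leadingTermClauses_imp_relationAt hGZ hGZK hmodD (by decide) hX.typeGOrd hX.addv.2
    (semistabilityIndex_eq_two_of_typeG_three W hX.typeGOrd.typeG hX.addv.2) hr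
    (hX.delbourgo2002_three hDel3 hcm).2

/-- **ERRATUM witness on X3♯(G-ord, `e = 2`)** (`ClassX3Gord.…_of_delbourgo_of_forall_censusX42…`,
`p ≥ 5`, non-CM explicit). [cite: Delbourgo2002, Theorem (A), (B) (p. 40)] -/
theorem ClassX3Gord.not_forall_leadingTermClauses_imp_censusX42_of_delbourgo
    (hDel : Delbourgo2002.mainTheorem) (hGZ : GrossZagier1986_thm_I_7_3)
    (hGZK : rank_eq_analyticRank_of_analyticRank_le_one)
    (hmodD : nonempty_modularParametrizationData) (hX : ClassX3Gord W p)
    (he : semistabilityIndex W p = 2) (hp5 : 5 ≤ p) (hcm : ¬ W.HasCM) (hr : W.analyticRank = 1) :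
    ¬ ∀ Dh : PAdicHeightData W p, LeadingTermClauses W p Dh → RelationAt W p Dh :=
  not_forall_leadingTermClauses_imp_relationAt hGZ hGZK hmodD (by omega) hX.typeGOrd hX.addv he hr
    (hDel.exists_leadingTermClauses hp5 hcm hX.1.2 hX.2)

/-- **ERRATUM witness on X3♯(G-ord)@3** (`ClassX3Gord.bsdp_three_rankOne_of_wuthrichHalf_of_delbourgo_of_forall_censusX42_of_shaAn_unit`).
[cite: Delbourgo2002, Theorem (A), (B), Example (p. 40)] -/
theorem ClassX3Gord.not_forall_leadingTermClauses_imp_censusX42_three_of_delbourgo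
    [Fact (Nat.Prime 3)] {W : WeierstrassCurve ℚ} [W.IsElliptic] [W.IsGloballyMinimal]
    (hDel3 : Delbourgo2002.mainTheorem_three) (hGZ : GrossZagier1986_thm_I_7_3)
    (hGZK : rank_eq_analyticRank_of_analyticRank_le_one)
    (hmodD : nonempty_modularParametrizationData) (hX : ClassX3Gord W 3) (hcm : ¬ W.HasCM)
    (hr : W.analyticRank = 1) :
    ¬ ∀ Dh : PAdicHeightData W 3, LeadingTermClauses W 3 Dh → RelationAt W 3 Dh :=
  not_forall_leadingTermClauses_imp_relationAt hGZ hGZK hmodD (by decide) hX.typeGOrd hX.addv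
    (semistabilityIndex_eq_two_of_typeG_three W hX.typeGOrd.typeG hX.addv) hr
    (hX.delbourgo2002_three hDel3 hcm).2

end Summit.BirchSwinnertonDyer.Rank1Residual.Additive

namespace Summit.BirchSwinnertonDyer.Rank1Residual.AdditivePotMult

open Additive CensusX42

variable {W : WeierstrassCurve ℚ} [W.IsElliptic] [W.IsGloballyMinimal] {p : ℕ} [hp : Fact p.Prime]

/-- **ERRATUM witness on X4(M)** (`ClassX4M.bsdp_rankOne_of_katoHalf_of_delbourgo_of_forall_censusX42_of_shaAn_unit`,
`ClassX4M.bsdp_of_forall_censusX42_of_katoHalf_of_multCert`, and the `hDelM`-carrying (M) nodes of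
p259429 / p260391): EVERY odd `p`, `r_an = 1`. [cite: Delbourgo2002, Theorem (A), (B), Example (p. 40)] -/
theorem ClassX4M.not_forall_leadingTermClauses_imp_censusX42_of_delbourgo
    (hDelM : Delbourgo2002.mainTheorem_potMult) (hGZ : GrossZagier1986_thm_I_7_3)
    (hGZK : rank_eq_analyticRank_of_analyticRank_le_one)
    (hmodD : nonempty_modularParametrizationData) (hX : ClassX4M W p) (hr : W.analyticRank = 1) :
    ¬ ∀ Dh : PAdicHeightData W p, LeadingTermClauses W p Dh → RelationAt W p Dh :=
  not_forall_leadingTermClauses_imp_relationAt_mult_of_delbourgo hDelM hGZ hGZK hmodD hX.p_ne_two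
    hX.potMult hr

/-- **ERRATUM witness on X3♯(M)** (`ClassX3M.bsdp_rankOne_of_wuthrichHalf_of_delbourgo_of_forall_censusX42_of_shaAn_unit`
and the `hDelM`-carrying X3♯(M) nodes): EVERY odd `p`, `r_an = 1`.
[cite: Delbourgo2002, Theorem (A), (B), Example (p. 40)] -/
theorem ClassX3M.not_forall_leadingTermClauses_imp_censusX42_of_delbourgo
    (hDelM : Delbourgo2002.mainTheorem_potMult) (hGZ : GrossZagier1986_thm_I_7_3)
    (hGZK : rank_eq_analyticRank_of_analyticRank_le_one)
    (hmodD : nonempty_modularParametrizationData) (hX : ClassX3M W p) (hr : W.analyticRank = 1) :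
    ¬ ∀ Dh : PAdicHeightData W p, LeadingTermClauses W p Dh → RelationAt W p Dh :=
  not_forall_leadingTermClauses_imp_relationAt_mult_of_delbourgo hDelM hGZ hGZK hmodD hX.p_ne_two
    hX.potMult hr

end Summit.BirchSwinnertonDyer.Rank1Residual.AdditivePotMult

end
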